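import Literature.RingTheory.LocalCohomology.CechFiniteness
import Literature.AlgebraicGeometry.Resolution.FiniteOverCompleteLocal
import HarnessLib

/-!
# Čech lemmas for Grothendieck's connectedness theorem

Topic `Literature/RingTheory/LocalCohomology`, sequel of `CechComplex.lean`, `CechTorsion.lean`,
`CechDepth.lean`, `CechFiniteness.lean`. Elementary module-theoretic lemmas used by the proof of
Grothendieck's connectedness theorem (SGA 2 XIII 2.1, `GrothendieckConnectednessProofs.lean`), in
which the sections of `M/g^N M` over a punctured neighbourhood `Spec D ∖ V(y_1, …, y_s)` are read as
Čech `0`-cocycles `Z⁰(y; M/g^N M)`: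

* splitting by coprime torsion (`eq_zero_of_torsion_of_torsion`, `exists_add_of_torsion`,
  `exists_split_cocycle`, `cocycle_split_unique`): if `V(𝔞₁) ∩ V(𝔞₂) ⊆ V(y)` and `𝔞₁ 𝔞₂ (y)` kills
  the module, a Čech `0`-cocycle splits uniquely as a sum of an `𝔞₁`-torsion and an `𝔞₂`-torsion
  cocycle (the sections over a disjoint union of two closed pieces);
* the `g`-power chase (`toQuot_eq_zero_of_cechAug_eq_zero`, `exists_cechAug_toQuot_eq_pow_smul`):
  for a module `M` of depth `≥ 2` along `(y)` whose `H²` has `g`-power torsion bounded by `g^{N₀}`,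
  `M/g^N M → Z⁰(y; M/g^N M)` is injective with cokernel killed by `g^{N₀}`;
* `g`-adic limits in a finite module over a complete local ring (`exists_sub_mem_pow_smul_of_compatible`);
* Krull's intersection theorem at a prime, for torsion-free modules (`eq_zero_of_forall_exists_smul_mem`).

Everything is proved; no definitions, no named facts.

## References

* [Grothendieck1968SGA2] A. Grothendieck, SGA 2, Exp. XIII §2 (arXiv:math/0511279, p. 95).
* [Matsumura1987] H. Matsumura, *Commutative Ring Theory*, CUP 1986, Thm. 8.7, Thm. 8.10 (Krull).
-/

noncomputable section

open CategoryTheory IsLocalRing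

universe u

namespace Literature.RingTheory.LocalCohomology

variable {R : Type u} [CommRing R] {s : ℕ} {y : Fin s → R}

/-! ## Splitting a module by two coprime torsion conditions -/

section Split

variable {P : Type u} [AddCommGroup P] [Module R P] {I J : Ideal R} {w : R}

/-- If `w^L ∈ I + J` and `w` acts injectively, an element killed by `I` and by `J` is zero.
[folklore] -/
theorem eq_zero_of_torsion_of_torsion (hw : ∃ L : ℕ, w ^ L ∈ I ⊔ J)
    (hinj : ∀ L : ℕ, Function.Injective fun p : P => w ^ L • p) (q : P)
    (hI : ∀ a ∈ I, a • q = 0) (hJ : ∀ b ∈ J, b • q = 0) : q = 0 := by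
  obtain ⟨L, hL⟩ := hw
  obtain ⟨u, hu, v, hv, huv⟩ := Submodule.mem_sup.mp hL
  apply hinj L
  dsimp only
  rw [smul_zero, ← huv, add_smul, hI u hu, hJ v hv, add_zero]

/-- If `w^L ∈ I + J`, `w` acts surjectively and `I J` kills `P`, every element is the sum of an
element killed by `I` and an element killed by `J`. [folklore] -/
theorem exists_add_of_torsion (hw : ∃ L : ℕ, w ^ L ∈ I ⊔ J)
    (hsurj : ∀ L : ℕ, Function.Surjective fun p : P => w ^ L • p)
    (hIJ : ∀ a ∈ I, ∀ b ∈ J, ∀ p : P, (a * b) • p = 0) (p : P) :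
    ∃ p₁ p₂ : P, p = p₁ + p₂ ∧ (∀ a ∈ I, a • p₁ = 0) ∧ (∀ b ∈ J, b • p₂ = 0) := by
  obtain ⟨L, hL⟩ := hw
  obtain ⟨u, hu, v, hv, huv⟩ := Submodule.mem_sup.mp hL
  obtain ⟨p', hp'⟩ := hsurj L p
  dsimp only at hp'
  refine ⟨v • p', u • p', ?_, fun a ha => ?_, fun b hb => ?_⟩
  · rw [← hp', ← huv, add_smul, add_comm]
  · rw [smul_smul, hIJ a ha v hv]
  · rw [smul_smul, mul_comm, hIJ u hu b hb]

end Split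

/-! ## Splitting Čech cocycles -/

section SplitCech

variable {N' : Type u} [AddCommGroup N'] [Module R N'] {I J : Ideal R}

/-- A power of `y_t` lies in `I + J` as soon as a power of each `y_i` does. [folklore] -/
theorem exists_pow_tupleProd_mem_sup (hy : ∀ i, ∃ L : ℕ, y i ^ L ∈ I ⊔ J) {n : ℕ}
    (t : Fin (n + 1) → Fin s) : ∃ L : ℕ, tupleProd y t ^ L ∈ I ⊔ J := by
  obtain ⟨L, hL⟩ := hy (t 0)
  refine ⟨L, ?_⟩
  have : tupleProd y t = y (t 0) * ∏ k : Fin n, y (t k.succ) := by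
    unfold tupleProd
    rw [Fin.prod_univ_succ]
  rw [this, mul_pow]
  exact Ideal.mul_mem_right _ _ hL

/-- In `N'_{y_t}`, an element killed by `I` and by `J` vanishes (when `V(I) ∩ V(J) ⊆ V(y)`).
[folklore] -/
theorem cechLoc_eq_zero_of_torsion (hy : ∀ i, ∃ L : ℕ, y i ^ L ∈ I ⊔ J) {n : ℕ}
    (t : Fin (n + 1) → Fin s) (q : CechLoc y N' t) (hI : ∀ a ∈ I, a • q = 0)
    (hJ : ∀ b ∈ J, b • q = 0) : q = 0 :=
  eq_zero_of_torsion_of_torsion (exists_pow_tupleProd_mem_sup hy t)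
    (fun L => pow_smul_injective (y := y) (M := N') (u := t) (t := t) ⟨1, by rw [pow_one]⟩ L) q hI hJ

/-- **Splitting a Čech `0`-cocycle by coprime torsion.** Suppose a power of every `y_i` lies in
`I + J` and `a b y_iⁿ` kills `N'` for all `a ∈ I`, `b ∈ J`, `i`. Then every `0`-cocycle `c` of
`Č(y; N')` is uniquely `c = c₁ + c₂` with `c₁`, `c₂` cocycles, `I c₁ = 0`, `J c₂ = 0` (on each
`N'_{y_i}` the ideals `I`, `J` become comaximal with zero product). This is the decomposition of the
sections of `Ñ'` over `⋃ D(y_i)` along the disjoint closed pieces `V(I)`, `V(J)`. [folklore] -/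
theorem exists_split_cocycle (hy : ∀ i, ∃ L : ℕ, y i ^ L ∈ I ⊔ J) {n : ℕ}
    (hIJ : ∀ a ∈ I, ∀ b ∈ J, ∀ (i : Fin s) (m : N'), (a * b * y i ^ n) • m = 0)
    (c : CechObj y N' 0) (hc : dC 0 c = 0) :
    ∃ c₁ c₂ : CechObj y N' 0, c = c₁ + c₂ ∧ dC 0 c₁ = 0 ∧ dC 0 c₂ = 0 ∧
      (∀ a ∈ I, a • c₁ = 0) ∧ (∀ b ∈ J, b • c₂ = 0) := by
  -- `I J` kills every localisation `N'_{y_t}`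
  have hIJ' : ∀ {k : ℕ} (t : Fin (k + 1) → Fin s), ∀ a ∈ I, ∀ b ∈ J, ∀ p : CechLoc y N' t,
      (a * b) • p = 0 := by
    intro k t a ha b hb p
    induction p using LocalizedModule.induction_on with
    | h m u =>
      obtain ⟨u, hu⟩ := u
      rw [LocalizedModule.smul'_mk, ← LocalizedModule.zero_mk ⟨u, hu⟩, LocalizedModule.mk_eq]
      refine ⟨⟨tupleProd y t ^ n, n, rfl⟩, ?_⟩
      simp only [smul_zero, Submonoid.smul_def, smul_smul]
      have ht : tupleProd y t ^ n = y (t 0) ^ n * (∏ j : Fin k, y (t j.succ)) ^ n := by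
        unfold tupleProd
        rw [Fin.prod_univ_succ, mul_pow]
      rw [ht, show (y (t 0) ^ n * (∏ j : Fin k, y (t j.succ)) ^ n * (u * (a * b))) =
        ((∏ j : Fin k, y (t j.succ)) ^ n * u) * (a * b * y (t 0) ^ n) by ring, mul_smul,
        hIJ a ha b hb (t 0) m, smul_zero]
  -- componentwise splitting
  have hsplit : ∀ t : Fin 1 → Fin s, ∃ p₁ p₂ : CechLoc y N' t, c t = p₁ + p₂ ∧
      (∀ a ∈ I, a • p₁ = 0) ∧ (∀ b ∈ J, b • p₂ = 0) := fun t =>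
    exists_add_of_torsion (exists_pow_tupleProd_mem_sup hy t)
      (fun L => fun z => exists_pow_smul_eq t L z) (hIJ' t) (c t)
  choose c₁ c₂ hc₁₂ hc₁ hc₂ using hsplit
  have hsum : c = c₁ + c₂ := funext hc₁₂
  have hIc₁ : ∀ a ∈ I, a • (c₁ : CechObj y N' 0) = 0 := fun a ha => funext fun t => hc₁ t a ha
  have hJc₂ : ∀ b ∈ J, b • (c₂ : CechObj y N' 0) = 0 := fun b hb => funext fun t => hc₂ t b hb
  -- `d c₁` is killed by `I` and by `J`, hence vanishes
  have hd₁ : dC 0 (c₁ : CechObj y N' 0) = 0 := by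
    have hd : dC 0 (c₁ : CechObj y N' 0) = - dC 0 c₂ := by
      rw [eq_neg_iff_add_eq_zero, ← map_add, ← hsum, hc]
    funext t
    refine cechLoc_eq_zero_of_torsion hy t _ (fun a ha => ?_) (fun b hb => ?_)
    · rw [← Pi.smul_apply, ← LinearMap.map_smul, hIc₁ a ha, map_zero]; rfl
    · rw [hd, Pi.neg_apply, smul_neg, ← Pi.smul_apply, ← LinearMap.map_smul, hJc₂ b hb, map_zero,
        Pi.zero_apply, neg_zero]
  refine ⟨c₁, c₂, hsum, hd₁, ?_, hIc₁, hJc₂⟩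
  have := congrArg (dC 0) hsum
  rw [hc, map_add, hd₁] at this
  simpa using this.symm

/-- **Uniqueness of the splitting**: two decompositions `c₁ + c₂ = c₁' + c₂'` of a `0`-cochain with
`I c₁ = I c₁' = 0`, `J c₂ = J c₂' = 0` agree. [folklore] -/
theorem cocycle_split_unique (hy : ∀ i, ∃ L : ℕ, y i ^ L ∈ I ⊔ J)
    {c₁ c₂ c₁' c₂' : CechObj y N' 0} (h : c₁ + c₂ = c₁' + c₂')
    (h₁ : ∀ a ∈ I, a • c₁ = 0) (h₂ : ∀ b ∈ J, b • c₂ = 0)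
    (h₁' : ∀ a ∈ I, a • c₁' = 0) (h₂' : ∀ b ∈ J, b • c₂' = 0) : c₁ = c₁' := by
  have hq : c₁ - c₁' = c₂' - c₂ := by
    rw [sub_eq_iff_eq_add, sub_add_eq_add_sub, eq_sub_iff_add_eq, h, add_comm]
  rw [← sub_eq_zero]
  funext t
  refine cechLoc_eq_zero_of_torsion hy t _ (fun a ha => ?_) (fun b hb => ?_)
  · rw [Pi.sub_apply, smul_sub, ← Pi.smul_apply, ← Pi.smul_apply, h₁ a ha, h₁' a ha, sub_self]
  · rw [hq, Pi.sub_apply, smul_sub, ← Pi.smul_apply, ← Pi.smul_apply, h₂ b hb, h₂' b hb, sub_self]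

end SplitCech

/-! ## The `g`-power chase: `M/g^N M → Z⁰(M/g^N M)` -/

section Chase

variable {M : Type u} [AddCommGroup M] [Module R M]

open Pointwise

/-- If `M → Č⁰(M)` is injective with image the cocycles (depth `≥ 2`) and `x` is `M`-regular, then
`M/xM → Č⁰(M/xM)` is injective (`H⁰_{(y)}(M/xM) = 0`). [folklore] -/
theorem toQuot_eq_zero_of_cechAug_eq_zero {x : R} (hx : IsSMulRegular M x)
    (hM0 : ∀ m : M, cechAug y M m = 0 → m = 0)
    (hM1 : ∀ c : CechObj y M 0, dC 0 c = 0 → ∃ m : M, cechAug y M m = c) (m : M)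
    (h : cechAug y (QuotSMulTop x M) (toQuot x m) = 0) : toQuot x m = 0 := by
  rw [cechAug_map] at h
  obtain ⟨β, hβ⟩ := exists_eq_smul_of_cechObjMap_toQuot_eq_zero x 0 _ h
  have hdβ : dC 0 β = 0 := by
    apply isSMulRegular_cechObj hx 1
    dsimp only
    rw [smul_zero, ← LinearMap.map_smul, ← hβ, dC_cechAug]
  obtain ⟨b, hb⟩ := hM1 β hdβ
  have hm : m = x • b := by
    rw [← sub_eq_zero]
    apply hM0
    rw [map_sub, LinearMap.map_smul, hb, ← hβ, sub_self]
  rw [hm, LinearMap.map_smul, smul_quot]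

/-- **The cokernel of `M/g^N M → Z⁰(M/g^N M)` is killed by `g^{N₀}`** when `M` has depth `≥ 2` along
`(y)` (`M ≅ Z⁰(M)`), `g` is `M`-regular, and the `g`-power torsion of `H²(M)` is killed by `g^{N₀}`:
every cocycle `γ ∈ Z⁰(y; M/g^N M)` has `g^{N₀} γ` in the image of `M`. (From the exact sequence
`0 → M →g^N M → M/g^N M → 0`: `Z⁰(M/g^N M)/M ↪ H²(M)[g^N]`.) [folklore] -/
theorem exists_cechAug_toQuot_eq_pow_smul {g : R} (hg : IsSMulRegular M g) (N N₀ : ℕ)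
    (hM1 : ∀ c : CechObj y M 0, dC 0 c = 0 → ∃ m : M, cechAug y M m = c)
    (hN₀ : ∀ z : CechObj y M 1, dC 1 z = 0 →
      (∃ (k : ℕ) (w : CechObj y M 0), dC 0 w = g ^ k • z) → ∃ w : CechObj y M 0, dC 0 w = g ^ N₀ • z)
    (γ : CechObj y (QuotSMulTop (g ^ N) M) 0) (hγ : dC 0 γ = 0) :
    ∃ a : M, cechAug y (QuotSMulTop (g ^ N) M) (toQuot (g ^ N) a) = g ^ N₀ • γ := by
  have hgN : IsSMulRegular M (g ^ N) := hg.pow N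
  obtain ⟨c, z, hc, hcz, hz⟩ := exists_cocycle_of_Z0_quot (y := y) (x := g ^ N) hgN γ hγ
  obtain ⟨w', hw'⟩ := hN₀ z hz ⟨N, c, hcz⟩
  have hdβ : dC 0 (g ^ N₀ • c - g ^ N • w' : CechObj y M 0) = 0 := by
    rw [map_sub, LinearMap.map_smul, LinearMap.map_smul, hcz, hw', smul_smul, smul_smul,
      pow_mul_comm, sub_self]
  obtain ⟨a, ha⟩ := hM1 _ hdβ
  refine ⟨a, ?_⟩
  rw [cechAug_map (y := y) (toQuot (M := M) (g ^ N)) a, ha, map_sub, LinearMap.map_smul,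
    LinearMap.map_smul, hc, smul_cechObj_quot (g ^ N), sub_zero]

end Chase

/-! ## `g`-adic limits in finite modules over complete local rings -/

section Limit

variable {D : Type u} [CommRing D] [IsNoetherianRing D] [IsLocalRing D]
  [IsAdicComplete (maximalIdeal D) D] {M : Type u} [AddCommGroup M] [Module D M] [Module.Finite D M]

open Pointwise

/-- **`g`-adic limits.** Let `M` be a finite module over a complete Noetherian local ring `(D, 𝔪)` and
`g ∈ 𝔪`. A sequence `(a_N)` in `M` with `a_{N+1} − a_N ∈ g^N M` has a limit `a` with
`a − a_N ∈ g^N M` for every `N` (`M` is `𝔪`-adically complete, Matsumura Thm. 8.7; the tails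
`Σ_{k ≥ N} g^{k−N} b_k` converge and `a − a_N = g^N · Σ_{k ≥ N} g^{k−N} b_k`).
[cite: Matsumura1987, Thm. 8.7] -/
theorem exists_sub_mem_pow_smul_of_compatible {g : D} (hg : g ∈ maximalIdeal D) (f : ℕ → M)
    (hf : ∀ N, f (N + 1) - f N ∈ (g ^ N • ⊤ : Submodule D M)) :
    ∃ a : M, ∀ N, a - f N ∈ (g ^ N • ⊤ : Submodule D M) := by
  haveI : IsAdicComplete (maximalIdeal D) M :=
    Literature.AlgebraicGeometry.Resolution.isAdicComplete_of_finite (maximalIdeal D) M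
  -- `f (N+1) - f N = g^N • b N`
  have hb : ∀ N, ∃ b : M, f (N + 1) - f N = g ^ N • b := fun N => by
    obtain ⟨b, -, hb⟩ := (Submodule.mem_smul_pointwise_iff_exists _ _ _).mp (hf N)
    exact ⟨b, hb.symm⟩
  choose b hb using hb
  -- tails `t N K = Σ_{k < K} g^k • b (N + k)`, with `f (N + K) = f N + g^N • t N K`
  let t : ℕ → ℕ → M := fun N K => ∑ k ∈ Finset.range K, g ^ k • b (N + k)
  have ht : ∀ N K, f (N + K) = f N + g ^ N • t N K := by
    intro N K
    induction K with
    | zero => simp [t]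
    | succ K ih =>
      rw [show t N (K + 1) = t N K + g ^ K • b (N + K) from Finset.sum_range_succ _ _, smul_add,
        ← add_assoc (f N), ← ih, smul_smul, ← pow_add, ← hb (N + K), add_sub_cancel, Nat.add_assoc]
  have hmem : ∀ n : ℕ, ∀ m : M, g ^ n • m ∈ (maximalIdeal D ^ n • ⊤ : Submodule D M) :=
    fun n m => Submodule.smul_mem_smul (Ideal.pow_mem_pow hg n) Submodule.mem_top
  -- the tails are Cauchy, hence converge
  have hcauchy : ∀ N, ∀ {K K'}, K ≤ K' →
      t N K ≡ t N K' [SMOD (maximalIdeal D ^ K • ⊤ : Submodule D M)] := by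
    intro N K K' hKK'
    rw [SModEq.sub_mem]
    obtain ⟨c, rfl⟩ := Nat.exists_eq_add_of_le hKK'
    have : t N K - t N (K + c) = - ∑ k ∈ Finset.range c, g ^ (K + k) • b (N + (K + k)) := by
      simp only [t, Finset.sum_range_add, ← sub_sub, sub_self, zero_sub]
    rw [this, neg_mem_iff]
    refine Submodule.sum_mem _ fun k _ => ?_
    rw [pow_add, mul_smul]
    exact hmem K _
  have hlim : ∀ N, ∃ B : M, ∀ K, t N K ≡ B [SMOD (maximalIdeal D ^ K • ⊤ : Submodule D M)] :=
    fun N => IsPrecomplete.prec inferInstance (hcauchy N)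
  choose B hB using hlim
  -- the whole sequence is Cauchy, hence converges
  have hcauchy' : ∀ {K K'}, K ≤ K' → f K ≡ f K' [SMOD (maximalIdeal D ^ K • ⊤ : Submodule D M)] := by
    intro K K' hKK'
    rw [SModEq.sub_mem]
    obtain ⟨c, rfl⟩ := Nat.exists_eq_add_of_le hKK'
    rw [ht K c, sub_add_cancel_left, neg_mem_iff]
    exact hmem K _
  obtain ⟨a, ha⟩ := IsPrecomplete.prec (inferInstance : IsPrecomplete (maximalIdeal D) M) hcauchy'
  refine ⟨a, fun N => ?_⟩
  -- `a - f N - g^N • B N` lies in every `𝔪^K M`, hence vanishes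
  have hzero : a - f N - g ^ N • B N = 0 := by
    refine IsHausdorff.haus (inferInstance : IsHausdorff (maximalIdeal D) M) _ fun K => ?_
    rw [SModEq.sub_mem, sub_zero]
    have h1 : a - f (N + K) ∈ (maximalIdeal D ^ K • ⊤ : Submodule D M) := by
      have := (ha (N + K)).symm
      rw [SModEq.sub_mem] at this
      exact (Submodule.smul_mono_left (Ideal.pow_le_pow_right (Nat.le_add_left K N))) this
    have h2 : g ^ N • t N K - g ^ N • B N ∈ (maximalIdeal D ^ K • ⊤ : Submodule D M) := by
      rw [← smul_sub]
      have := hB N K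
      rw [SModEq.sub_mem] at this
      exact Submodule.smul_mem _ _ this
    have : a - f N - g ^ N • B N = (a - f (N + K)) + (g ^ N • t N K - g ^ N • B N) := by
      rw [ht N K]; abel
    rw [this]
    exact Submodule.add_mem _ h1 h2
  rw [sub_eq_zero] at hzero
  rw [hzero]
  exact Submodule.smul_mem_pointwise_smul _ _ _ Submodule.mem_top

end Limit

/-! ## Krull's intersection theorem at a prime, for torsion-free modules -/

section Krull

variable {D : Type u} [CommRing D] [IsNoetherianRing D] {M : Type u} [AddCommGroup M] [Module D M]
  [Module.Finite D M]

open Pointwise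

/-- **Krull at a prime.** Let `M` be a finite torsion-free module over the Noetherian domain `D`,
`Q` a prime, `g ∈ Q`, and `a ∈ M` such that for every `N` some `u ∉ Q` has `u a ∈ g^N M`. Then
`a = 0`: in the localisation `M_Q`, `a ∈ ⋂_N (Q D_Q)^N M_Q = 0` (Krull's intersection theorem,
Matsumura Thm. 8.10), so `v a = 0` for some `v ∉ Q`. [cite: Matsumura1987, Thm. 8.10] -/
theorem eq_zero_of_forall_exists_smul_mem (htf : ∀ (d : D) (m : M), d • m = 0 → d = 0 ∨ m = 0)
    {Q : Ideal D} [Q.IsPrime] {g : D} (hg : g ∈ Q) (a : M)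
    (h : ∀ N : ℕ, ∃ u : D, u ∉ Q ∧ u • a ∈ (g ^ N • ⊤ : Submodule D M)) : a = 0 := by
  let DQ := Localization.AtPrime Q
  let MQ := LocalizedModule Q.primeCompl M
  -- `a/1 ∈ (Q D_Q)^N M_Q` for all `N`
  have hmem : ∀ N : ℕ, (LocalizedModule.mk a 1 : MQ) ∈
      (maximalIdeal DQ ^ N • ⊤ : Submodule DQ MQ) := by
    intro N
    obtain ⟨u, huQ, hu⟩ := h N
    have huQ' : u ∈ Q.primeCompl := huQ
    obtain ⟨m, -, hm⟩ := (Submodule.mem_smul_pointwise_iff_exists _ _ _).mp hu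
    have hgm : (algebraMap D DQ g) ^ N • (LocalizedModule.mk m 1 : MQ) ∈
        (maximalIdeal DQ ^ N • ⊤ : Submodule DQ MQ) := by
      refine Submodule.smul_mem_smul (Ideal.pow_mem_pow ?_ N) Submodule.mem_top
      rw [← Localization.AtPrime.map_eq_maximalIdeal]
      exact Ideal.mem_map_of_mem _ hg
    have hu' : (algebraMap D DQ u) • (LocalizedModule.mk a 1 : MQ) =
        (algebraMap D DQ g) ^ N • LocalizedModule.mk m 1 := by
      rw [algebraMap_smul, LocalizedModule.smul'_mk, ← map_pow, algebraMap_smul,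
        LocalizedModule.smul'_mk, hm]
    obtain ⟨U, hU⟩ := IsLocalization.map_units DQ (⟨u, huQ'⟩ : Q.primeCompl)
    have hmk : (LocalizedModule.mk a 1 : MQ) = U⁻¹ • (U • LocalizedModule.mk a 1) :=
      (inv_smul_smul U _).symm
    rw [hmk, Units.smul_def, Units.smul_def, hU]
    change ((U⁻¹ : DQˣ) : DQ) • (algebraMap D DQ u • (LocalizedModule.mk a 1 : MQ)) ∈ _
    rw [hu']
    exact Submodule.smul_mem _ _ hgm
  have hbot : (⨅ i : ℕ, maximalIdeal DQ ^ i • ⊤ : Submodule DQ MQ) = ⊥ :=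
    (maximalIdeal DQ).iInf_pow_smul_eq_bot_of_isLocalRing (maximalIdeal.isMaximal DQ).ne_top
  have ha0 : (LocalizedModule.mk a 1 : MQ) = 0 := by
    rw [← Submodule.mem_bot DQ, ← hbot, Submodule.mem_iInf]
    exact hmem
  -- so `v a = 0` for some `v ∉ Q`
  rw [← LocalizedModule.zero_mk 1, LocalizedModule.mk_eq] at ha0
  obtain ⟨v, hv⟩ := ha0
  simp only [smul_zero, one_smul, Submonoid.smul_def] at hv
  rcases htf _ _ hv with h0 | h0
  · exact absurd (h0 ▸ Q.zero_mem) v.2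
  · exact h0

end Krull

end Literature.RingTheory.LocalCohomology

end
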